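import Mathlib
import Summits.ValiantsHypothesis.ValiantsHypothesis.Theses.FeketeSOS
import Summits.ValiantsHypothesis.ValiantsHypothesis.Theorems.FeketeSOSCharPSparseSOSStubWindowCounting
import Summits.ValiantsHypothesis.ValiantsHypothesis.Theorems.FeketeSOSCharPSparseSOSStubCharSum211
import Summits.ValiantsHypothesis.ValiantsHypothesis.Theorems.FeketeSOSCharPSparseSOSStubFourthMomentExpand
import Summits.ValiantsHypothesis.ValiantsHypothesis.Theorems.FeketeSOSCharPSparseSOSStubDegenerateQuadruples
import Summits.ValiantsHypothesis.ValiantsHypothesis.Theorems.FeketeSOSCharPSparseSOSStubFirstLemmaAssembly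

/-!
# Crux `FeketeSOS.CharPSparseSOS` (stmt-ValiantsHypothesis-14989) — line `Sketch-ideator5`
# (card `frobenius-trace-bias`, crux-ideate r2 ideator 5), lead skeleton v2

Spine.  For a prime `p` and `Q ⊆ [0,p)` put `Λ_Q(x) = Σ_{a∈Q} χ_p(x+a)` and, for a quadruple
`(a,b,c,d)`, the four-point sum `S_p(a,b,c,d) = Σ_{x<p} χ_p((x+a)(x+b)(x+c)(x+d))` (for pairwise distinct
entries `= −1 − a_p(y² = (x+a)(x+b)(x+c)(x+d))`, a Frobenius trace of the 4-point elliptic family).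

* `stub_traceBias` (card K1, OPEN): sets `Q` with `#Q ≥ (1−η)√p` have
  `Σ_{distinct (a,b,c,d)∈Q⁴} S_p ≤ (1−η)√p·#Q⁴` — a factor-`2/(1−η)` large deviation below Hasse on average
  over the product family `Q⁴`; proposed inputs: vertical Sato–Tate of the Legendre family + cross-ratio
  ℓ²-equidistribution of `Q⁴` (PGL₂(𝔽_p)-energy), the latter open at `#Q = √p`.  Its exact shadow
  (`monochromatic_translates_bound_of_traceBias`, landed p121683): a two-colour Paley biclique bound
  `#{x : x + Q ⊆ QR ∨ x + Q ⊆ NQR} ≤ (1−η)√p + O(1)` beyond completion (`√p/(1−η)`) — not in print.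
* `stub_transfer` (card K2+K3 made explicit, OPEN): a cheap cyclic representation of `F̄_p` over a field of
  characteristic `p` (`s ≤ p^{δ_t}` squares, support-sum `< p^{1/2+δ_t}`) produces ONE set `Q` in the window
  `#Q ≤ √p + p^{δ_w}` whose restricted pair-sum function is closer to `1_QR` than the robust-Shkredov bound
  allows (`3#Q + 2#Err + 13√p + 13 < p^{1/2+δ_w}`).  This is the crux modulo the far side of p112874; no
  engine is on record, and the lead's analysis (Lines/Sketch-ideator5-dead.md) shows the quartic lever cannot
  supply one for configurations with ≥ 2 fat pieces (pieces `≤ 0.71√p` < the lever's reach `0.849√p`).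
* The FIRST-LEMMA chain (card `FirstLemma`) is LANDED: stubs `stub_windowCounting` (p120955),
  `stub_charSum211` (p120624), `stub_fourthMomentExpand` (p120746), `stub_degenerateQuadruples` (p120827),
  `stub_firstLemmaAssembly` (p121409), composed in `robustShkredovWindow_of_traceBias` (p121683,
  Theorems/FeketeSOSCharPSparseSOSTraceBiasFirstLemma.lean): K1 ⇒ for every `0 < δ < 1/2` and all large
  `p`, every `Q` in the window satisfies p112874's conclusion `p^{1/2+δ} ≤ 3#Q + 2#Err + 13√p + 13`.
* `CharPSparseSOS_of` : `stub_traceBias`, `stub_transfer` and the First Lemma give the crux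
  (kernel-checked composition below).

All statements use Mathlib vocabulary only (no new definitions): `χ_p = legendreSym p`, `Q : Finset ℕ` with
`∀ a ∈ Q, a < p`, `r_Q(n) = #{(a,b) ∈ Q×Q : a < b, a+b ≡ n}` and `Err = {n < p : r_Q(n) ≠ 1_QR(n)}` written as
the same `Finset.filter` expressions as in `rQ_far_from_QR_of_charPSparseSOS` (p112874).
Disproof.lean (cdisprove cycle 1) read: `false_without_legendre` / `false_without_prime` are honoured (every stub
uses the values of `χ_p` on a prime field); no `-- Targets`.
-/

set_option linter.dupNamespace false

namespace Summit.ValiantsHypothesis.ValiantsHypothesis.Theorems.CharPSparseSOSTraceBias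

open Polynomial Finset
open scoped BigOperators

/-! ## First Lemma (glue over the landed stubs 3–7; landed verbatim, together with the K1 shadow
`monochromatic_translates_bound_of_traceBias`, as Theorems/FeketeSOSCharPSparseSOSTraceBiasFirstLemma.lean, p121683 —
inlined here so that this workfile elaborates independently of that module) -/


/-! ## The fourth-moment bound -/

/-- The `{u,u,v,w}` four-point sums are `≤ 0`: by `stub_charSum211` they equal `−1 − χ((v−u)(w−u)) ≤ 0`. -/
theorem charSum211_nonpos (p : ℕ) [Fact p.Prime] (hp : p ≠ 2) (u v w : ℕ) (hu : u < p) (hv : v < p)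
    (hw : w < p) (huv : u ≠ v) (huw : u ≠ w) (hvw : v ≠ w) :
    (∑ x ∈ range p, legendreSym p (((x : ℤ) + u) * ((x : ℤ) + u) * ((x : ℤ) + v) * ((x : ℤ) + w))) ≤ 0 := by
  rw [stub_charSum211 p hp u v w hu hv hw huv huw hvw]
  have := wc_neg_one_le_legendreSym p (((v : ℤ) - u) * ((w : ℤ) - u))
  linarith

/-- **Fourth-moment bound.**  `Σ_{x<p} Λ_Q(x)⁴ ≤ Σ_{distinct (a,b,c,d)∈Q⁴} S_p(a,b,c,d) + 16 p #Q²`: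
expand the fourth power (`stub_fourthMomentExpand`), split the quadruples into pairwise-distinct and
degenerate ones, and bound the degenerate ones by `stub_degenerateQuadruples` (the `{u,u,v,w}` sums being
`≤ 0` by `charSum211_nonpos`). -/
theorem fourthMoment_le (p : ℕ) [Fact p.Prime] (hp : p ≠ 2) (Q : Finset ℕ) (hQ : ∀ a ∈ Q, a < p) :
    (∑ x ∈ range p, (∑ a ∈ Q, legendreSym p ((x : ℤ) + a)) ^ 4) ≤
      (∑ t ∈ ((Q ×ˢ Q) ×ˢ (Q ×ˢ Q)).filter (fun t : (ℕ × ℕ) × (ℕ × ℕ) =>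
          t.1.1 ≠ t.1.2 ∧ t.1.1 ≠ t.2.1 ∧ t.1.1 ≠ t.2.2 ∧ t.1.2 ≠ t.2.1 ∧ t.1.2 ≠ t.2.2 ∧ t.2.1 ≠ t.2.2),
        ∑ x ∈ range p, legendreSym p
          (((x : ℤ) + t.1.1) * ((x : ℤ) + t.1.2) * ((x : ℤ) + t.2.1) * ((x : ℤ) + t.2.2))) +
      16 * (p : ℤ) * (Q.card : ℤ) ^ 2 := by
  rw [stub_fourthMomentExpand p Q]
  have h211 : ∀ u ∈ Q, ∀ v ∈ Q, ∀ w ∈ Q, u ≠ v → u ≠ w → v ≠ w →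
      (∑ x ∈ range p, legendreSym p
        (((x : ℤ) + u) * ((x : ℤ) + u) * ((x : ℤ) + v) * ((x : ℤ) + w))) ≤ 0 :=
    fun u hu v hv w hw huv huw hvw => charSum211_nonpos p hp u v w (hQ u hu) (hQ v hv) (hQ w hw) huv huw hvw
  have hdeg := stub_degenerateQuadruples p Q hQ h211
  rw [← sum_filter_add_sum_filter_not ((Q ×ˢ Q) ×ˢ (Q ×ˢ Q)) (fun t : (ℕ × ℕ) × (ℕ × ℕ) =>
      t.1.1 ≠ t.1.2 ∧ t.1.1 ≠ t.2.1 ∧ t.1.1 ≠ t.2.2 ∧ t.1.2 ≠ t.2.1 ∧ t.1.2 ≠ t.2.2 ∧ t.2.1 ≠ t.2.2)]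
  linarith

/-! ## The First Lemma: K1 ⇒ robust Shkredov in the window -/

/-- **First Lemma of the line** (card `frobenius-trace-bias`, `FirstLemma : TraceBias → RobustShkredovWindow`).
If `K1(η)` holds for some `η ∈ (0,1)` — for all large primes `p` and every `Q ⊆ [0,p)` with
`#Q ≥ (1−η)√p`, `Σ_{distinct} S_p ≤ (1−η)√p·#Q⁴` — then for every window exponent `0 < δ < 1/2` and
all large primes `p`, every `Q ⊆ [0,p)` with `#Q ≤ √p + p^δ` satisfies the conclusion of
`rQ_far_from_QR_of_charPSparseSOS` (p112874): `p^{1/2+δ} ≤ 3#Q + 2#{n < p : r_Q(n) ≠ 1_QR(n)} + 13√p + 13`.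
(Near-perfection gives coverage and `Σ_{x∈Q}Λ_Q ≈ p`; the power mean on `Q` and the fourth-moment bound
turn this into `Σ_{distinct} S_p ≥ (1−o(1))√p·#Q⁴`, contradicting K1.) -/
theorem robustShkredovWindow_of_traceBias :
    ∀ η : ℝ, 0 < η → η < 1 →
      (∃ p₀ : ℕ, ∀ (p : ℕ) [Fact p.Prime], p₀ ≤ p → ∀ Q : Finset ℕ, (∀ a ∈ Q, a < p) →
        (1 - η) * Real.sqrt p ≤ (Q.card : ℝ) →
        (∑ t ∈ ((Q ×ˢ Q) ×ˢ (Q ×ˢ Q)).filter (fun t : (ℕ × ℕ) × (ℕ × ℕ) =>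
            t.1.1 ≠ t.1.2 ∧ t.1.1 ≠ t.2.1 ∧ t.1.1 ≠ t.2.2 ∧ t.1.2 ≠ t.2.1 ∧ t.1.2 ≠ t.2.2 ∧ t.2.1 ≠ t.2.2),
          ((∑ x ∈ range p, legendreSym p
            (((x : ℤ) + t.1.1) * ((x : ℤ) + t.1.2) * ((x : ℤ) + t.2.1) * ((x : ℤ) + t.2.2)) : ℤ) : ℝ)) ≤
        (1 - η) * Real.sqrt p * (Q.card : ℝ) ^ 4) →
      ∀ δ : ℝ, 0 < δ → δ < 1 / 2 →
      ∃ p₁ : ℕ, ∀ (p : ℕ) [Fact p.Prime], p₁ ≤ p → ∀ Q : Finset ℕ, (∀ a ∈ Q, a < p) →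
        (Q.card : ℝ) ≤ Real.sqrt p + (p : ℝ) ^ δ →
        (p : ℝ) ^ (1 / 2 + δ) ≤ 3 * (Q.card : ℝ) +
          2 * (((range p).filter (fun n => ((Q ×ˢ Q).filter
              (fun ab : ℕ × ℕ => ab.1 < ab.2 ∧ (ab.1 + ab.2) % p = n)).card ≠
                (if n ≠ 0 ∧ legendreSym p n = 1 then 1 else 0))).card : ℝ) +
          13 * Real.sqrt p + 13 := by
  intro η hη hη1 hK1 δ hδ hδ2
  exact stub_firstLemmaAssembly η δ hη hη1 hδ hδ2 hK1 stub_windowCounting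
    (fun p _ hp Q hQ => fourthMoment_le p hp Q hQ)


/-! ## Registered stubs (open) -/

/-- **Stub 1 (K1 `TraceBias`, OPEN — held by the lead).**  There is `η ∈ (0,1)` such that for all large primes
`p` and every `Q ⊆ [0,p)` with `#Q ≥ (1−η)√p`, the sum of the four-point sums
`S_p(a,b,c,d) = Σ_{x<p} χ_p((x+a)(x+b)(x+c)(x+d))` over the pairwise-distinct quadruples of `Q` is at most
`(1−η)√p·#Q⁴`.  Termwise Hasse gives `2√p`; near-perfect Paley sum-configurations would force `≥ (1−o(1))√p`
(the First Lemma); random `Q` give `O(p^{−3/4+o(1)})√p`; adversarial maxima found by annealing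
decay (`0.51, 0.40, 0.39, 0.30, 0.196` of `√p` at `p = 103, 211, 331, 509, 1021`, kit j019369/j019385).
Exact shadow (landed, `monochromatic_translates_bound_of_traceBias`): no `√p`-set has more than
`(1−η)√p + O(1)` monochromatic translates — a constant-factor improvement of completion at the self-dual point. -/
theorem stub_traceBias :
    ∃ η : ℝ, 0 < η ∧ η < 1 ∧ ∃ p₀ : ℕ, ∀ (p : ℕ) [Fact p.Prime], p₀ ≤ p → ∀ Q : Finset ℕ, (∀ a ∈ Q, a < p) →
      (1 - η) * Real.sqrt p ≤ (Q.card : ℝ) →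
      (∑ t ∈ ((Q ×ˢ Q) ×ˢ (Q ×ˢ Q)).filter (fun t : (ℕ × ℕ) × (ℕ × ℕ) =>
          t.1.1 ≠ t.1.2 ∧ t.1.1 ≠ t.2.1 ∧ t.1.1 ≠ t.2.2 ∧ t.1.2 ≠ t.2.1 ∧ t.1.2 ≠ t.2.2 ∧ t.2.1 ≠ t.2.2),
        ((∑ x ∈ range p, legendreSym p
          (((x : ℤ) + t.1.1) * ((x : ℤ) + t.1.2) * ((x : ℤ) + t.2.1) * ((x : ℤ) + t.2.2)) : ℤ) : ℝ)) ≤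
      (1 - η) * Real.sqrt p * (Q.card : ℝ) ^ 4 := by
  sorry

/-- **Stub 2 (transfer, card K2 + K3 made explicit, OPEN — held by the lead).**  For some window exponent
`δ_w ∈ (0, 1/2)` and some `δ_t > 0`: every cyclic representation `X^p − 1 ∣ Σ_{i<s} c_i g_i² − F̄_p` over a
field of characteristic `p` with `s ≤ p^{δ_t}` squares of degree `< p` and support-sum `< p^{1/2+δ_t}` yields a
set `Q ⊆ [0,p)` with `#Q ≤ √p + p^{δ_w}` and `3#Q + 2#{n < p : r_Q(n) ≠ 1_QR(n)} + 13√p + 13 < p^{1/2+δ_w}`.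
(The card's route: unit-weight / prime-field descent of cost-minimal representations (K2, first step
`uniqueSum_rigidity`), one dominant near-Sidon square, polarised fourth moment (K3).  No cheap configuration is
known at all, so there is no data; the statement is the crux modulo the far side of p112874.) -/
theorem stub_transfer :
    ∃ δw : ℝ, 0 < δw ∧ δw < 1 / 2 ∧ ∃ δt : ℝ, 0 < δt ∧ ∃ p₀ : ℕ, ∀ (p : ℕ) [Fact p.Prime], p₀ ≤ p →
      ∀ (K : Type) [Field K] [CharP K p] (s : ℕ) (c : Fin s → K) (g : Fin s → K[X]),
      (s : ℝ) ≤ (p : ℝ) ^ δt → (∀ i, (g i).natDegree < p) →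
      ((X : K[X]) ^ p - 1 ∣ (∑ i, C (c i) * g i ^ 2) -
          ∑ m ∈ range p, C ((legendreSym p m : ℤ) : K) * X ^ m) →
      (∑ i, ((g i).support.card : ℝ)) < (p : ℝ) ^ (1 / 2 + δt) →
      ∃ Q : Finset ℕ, (∀ a ∈ Q, a < p) ∧ (Q.card : ℝ) ≤ Real.sqrt p + (p : ℝ) ^ δw ∧
        3 * (Q.card : ℝ) +
          2 * (((range p).filter (fun n => ((Q ×ˢ Q).filter
              (fun ab : ℕ × ℕ => ab.1 < ab.2 ∧ (ab.1 + ab.2) % p = n)).card ≠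
                (if n ≠ 0 ∧ legendreSym p n = 1 then 1 else 0))).card : ℝ) +
          13 * Real.sqrt p + 13 < (p : ℝ) ^ (1 / 2 + δw) := by
  sorry

/-! ## Composition -/

/-- **Composition.**  `stub_traceBias` (K1) and the landed First Lemma give robust Shkredov in the window
`δ_w` named by `stub_transfer`; a cyclic representation with `s ≤ p^{δ_t}` squares and support-sum
`< p^{1/2+δ_t}` would, by `stub_transfer`, produce a set violating it.  Hence the crux holds with `δ = δ_t`. -/
theorem CharPSparseSOS_of :
    Summit.ValiantsHypothesis.ValiantsHypothesis.Theses.FeketeSOS.CharPSparseSOS := by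
  unfold Summit.ValiantsHypothesis.ValiantsHypothesis.Theses.FeketeSOS.CharPSparseSOS
  obtain ⟨δw, hδw, hδw2, δt, hδt, p₀, hT⟩ := stub_transfer
  obtain ⟨η, hη, hη1, hK⟩ := stub_traceBias
  obtain ⟨p₁, hW⟩ := robustShkredovWindow_of_traceBias η hη hη1 hK δw hδw hδw2
  refine ⟨δt, hδt, max p₀ p₁, ?_⟩
  intro p _ hp K _ _ s c g hs hdeg hdvd
  by_contra hlt
  have hlt := not_le.mp hlt
  obtain ⟨Q, hQ, hwin, hfar⟩ := hT p (le_of_max_le_left hp) K s c g hs hdeg hdvd hlt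
  have := hW p (le_of_max_le_right hp) Q hQ hwin
  linarith

end Summit.ValiantsHypothesis.ValiantsHypothesis.Theorems.CharPSparseSOSTraceBias
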